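import Literature.MathematicalPhysics.QuantumLattice.HubbardFermiBandCurvature
import Mathlib.Analysis.Calculus.ContDiff.Basic
import HarnessLib

/-!
# The pair energy `ε(p + γ_μ(θ) + γ_μ(φ)) - μ` along the band Fermi curve and its slice derivatives

Topic `Literature/MathematicalPhysics/QuantumLattice`; continues `HubbardFermiBandCurvature`
(Cartesian parametrisation `(x, y) = (bandX, bandY)` of the level-`μ` curve of
`ε(k) = -2(cos k₁ + cos k₂)`, `-4 < μ < 0`, with velocity `(x', y')`, acceleration `(x'', y'')`).

For the torus sublevel estimate behind the `L²`-continuity of the Kohn–Luttinger kernel one studies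
the function `G(θ, φ) = ε(p + γ(θ) + γ(φ)) - μ` of two angles (parameters: the level `μ` and a
momentum `p = (p₁, p₂)`), written out as `pairE μ p θ φ = -2(cos X + cos Y) - μ`,
`X = p₁ + x(θ) + x(φ)`, `Y = p₂ + y(θ) + y(φ)` (`pairKX`, `pairKY`). This file provides:

* the five derivative quantities `pairE₁ = ∂_θ G`, `pairE₂ = ∂_φ G`, `pairE₁₁ = ∂²_θ G`,
  `pairE₂₂ = ∂²_φ G`, `pairE₁₂ = ∂_θ∂_φ G`, and the diagonal second derivative
  `pairEdd = ∂²_θ + 2∂_θ∂_φ + ∂²_φ` (definitions with bodies), with the `HasDerivAt` statements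
  along the `θ`-slices, the `φ`-slices and the diagonal slices `u ↦ G(w + u, u)`;
* joint continuity of `u''` in `(μ, θ)` (`continuousOn_bandRadiusDeriv2_uncurry`) and of all these
  quantities in `(μ, p, θ, φ)` on `{-4 < μ < 0}`;
* `2π`-periodicity in `p`.

Everything is proved; the definitions have bodies. [folklore]
-/

noncomputable section

open Real Set Filter
open scoped Topology ContDiff

namespace Literature.MathematicalPhysics.QuantumLattice

/-! ### Definitions -/

/-- First coordinate of the pair momentum `p + γ(θ) + γ(φ)`. [folklore] -/
def pairKX (μ : ℝ) (p : ℝ × ℝ) (θ φ : ℝ) : ℝ := p.1 + bandX μ θ + bandX μ φ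

/-- Second coordinate of the pair momentum `p + γ(θ) + γ(φ)`. [folklore] -/
def pairKY (μ : ℝ) (p : ℝ × ℝ) (θ φ : ℝ) : ℝ := p.2 + bandY μ θ + bandY μ φ

/-- **The pair energy** `G(θ, φ) = ε(p + γ_μ(θ) + γ_μ(φ)) - μ`. [folklore] -/
def pairE (μ : ℝ) (p : ℝ × ℝ) (θ φ : ℝ) : ℝ :=
  -2 * (Real.cos (pairKX μ p θ φ) + Real.cos (pairKY μ p θ φ)) - μ

/-- `∂_θ G = 2(sin X · x'(θ) + sin Y · y'(θ))`. [folklore] -/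
def pairE₁ (μ : ℝ) (p : ℝ × ℝ) (θ φ : ℝ) : ℝ :=
  2 * (Real.sin (pairKX μ p θ φ) * bandVX μ θ + Real.sin (pairKY μ p θ φ) * bandVY μ θ)

/-- `∂_φ G = 2(sin X · x'(φ) + sin Y · y'(φ))`. [folklore] -/
def pairE₂ (μ : ℝ) (p : ℝ × ℝ) (θ φ : ℝ) : ℝ :=
  2 * (Real.sin (pairKX μ p θ φ) * bandVX μ φ + Real.sin (pairKY μ p θ φ) * bandVY μ φ)

/-- `∂²_θ G`. [folklore] -/
def pairE₁₁ (μ : ℝ) (p : ℝ × ℝ) (θ φ : ℝ) : ℝ :=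
  2 * (Real.cos (pairKX μ p θ φ) * bandVX μ θ ^ 2 + Real.sin (pairKX μ p θ φ) * bandAX μ θ +
    (Real.cos (pairKY μ p θ φ) * bandVY μ θ ^ 2 + Real.sin (pairKY μ p θ φ) * bandAY μ θ))

/-- `∂²_φ G`. [folklore] -/
def pairE₂₂ (μ : ℝ) (p : ℝ × ℝ) (θ φ : ℝ) : ℝ :=
  2 * (Real.cos (pairKX μ p θ φ) * bandVX μ φ ^ 2 + Real.sin (pairKX μ p θ φ) * bandAX μ φ +
    (Real.cos (pairKY μ p θ φ) * bandVY μ φ ^ 2 + Real.sin (pairKY μ p θ φ) * bandAY μ φ))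

/-- `∂_θ ∂_φ G = 2(cos X · x'(θ)x'(φ) + cos Y · y'(θ)y'(φ))`. [folklore] -/
def pairE₁₂ (μ : ℝ) (p : ℝ × ℝ) (θ φ : ℝ) : ℝ :=
  2 * (Real.cos (pairKX μ p θ φ) * bandVX μ θ * bandVX μ φ + Real.cos (pairKY μ p θ φ) * bandVY μ θ * bandVY μ φ)

/-- The diagonal second derivative `(∂_θ + ∂_φ)² G`. [folklore] -/
def pairEdd (μ : ℝ) (p : ℝ × ℝ) (θ φ : ℝ) : ℝ :=
  pairE₁₁ μ p θ φ + 2 * pairE₁₂ μ p θ φ + pairE₂₂ μ p θ φ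

/-! ### Slice derivatives -/

section Band

variable {μ : ℝ} (hμ₁ : -4 < μ) (hμ₂ : μ < 0)
include hμ₁ hμ₂

/-- `θ`-slice: `∂_θ G = pairE₁`. [folklore] -/
theorem hasDerivAt_pairE_fst (p : ℝ × ℝ) (θ φ : ℝ) :
    HasDerivAt (fun t => pairE μ p t φ) (pairE₁ μ p θ φ) θ := by
  have hX : HasDerivAt (fun t => pairKX μ p t φ) (bandVX μ θ) θ := by
    have h := ((hasDerivAt_bandX hμ₁ hμ₂ θ).const_add p.1).add_const (bandX μ φ)
    exact h
  have hY : HasDerivAt (fun t => pairKY μ p t φ) (bandVY μ θ) θ := by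
    have h := ((hasDerivAt_bandY hμ₁ hμ₂ θ).const_add p.2).add_const (bandY μ φ)
    exact h
  have h := ((hX.cos.add hY.cos).const_mul (-2)).sub_const μ
  refine h.congr_deriv ?_
  simp only [pairE₁]; ring

/-- `θ`-slice: `∂_θ pairE₁ = pairE₁₁`. [folklore] -/
theorem hasDerivAt_pairE₁_fst (p : ℝ × ℝ) (θ φ : ℝ) :
    HasDerivAt (fun t => pairE₁ μ p t φ) (pairE₁₁ μ p θ φ) θ := by
  have hX : HasDerivAt (fun t => pairKX μ p t φ) (bandVX μ θ) θ := by
    have h := ((hasDerivAt_bandX hμ₁ hμ₂ θ).const_add p.1).add_const (bandX μ φ)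
    exact h
  have hY : HasDerivAt (fun t => pairKY μ p t φ) (bandVY μ θ) θ := by
    have h := ((hasDerivAt_bandY hμ₁ hμ₂ θ).const_add p.2).add_const (bandY μ φ)
    exact h
  have h := ((hX.sin.mul (hasDerivAt_bandVX hμ₁ hμ₂ θ)).add (hY.sin.mul (hasDerivAt_bandVY hμ₁ hμ₂ θ))).const_mul 2
  refine h.congr_deriv ?_
  simp only [pairE₁₁]; ring

/-- `φ`-slice: `∂_φ G = pairE₂`. [folklore] -/
theorem hasDerivAt_pairE_snd (p : ℝ × ℝ) (θ φ : ℝ) :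
    HasDerivAt (fun t => pairE μ p θ t) (pairE₂ μ p θ φ) φ := by
  have hX : HasDerivAt (fun t => pairKX μ p θ t) (bandVX μ φ) φ := by
    have h := (hasDerivAt_bandX hμ₁ hμ₂ φ).const_add (p.1 + bandX μ θ)
    exact h
  have hY : HasDerivAt (fun t => pairKY μ p θ t) (bandVY μ φ) φ := by
    have h := (hasDerivAt_bandY hμ₁ hμ₂ φ).const_add (p.2 + bandY μ θ)
    exact h
  have h := ((hX.cos.add hY.cos).const_mul (-2)).sub_const μ
  refine h.congr_deriv ?_
  simp only [pairE₂]; ring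

/-- `φ`-slice: `∂_φ pairE₂ = pairE₂₂`. [folklore] -/
theorem hasDerivAt_pairE₂_snd (p : ℝ × ℝ) (θ φ : ℝ) :
    HasDerivAt (fun t => pairE₂ μ p θ t) (pairE₂₂ μ p θ φ) φ := by
  have hX : HasDerivAt (fun t => pairKX μ p θ t) (bandVX μ φ) φ := by
    have h := (hasDerivAt_bandX hμ₁ hμ₂ φ).const_add (p.1 + bandX μ θ)
    exact h
  have hY : HasDerivAt (fun t => pairKY μ p θ t) (bandVY μ φ) φ := by
    have h := (hasDerivAt_bandY hμ₁ hμ₂ φ).const_add (p.2 + bandY μ θ)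
    exact h
  have h := ((hX.sin.mul (hasDerivAt_bandVX hμ₁ hμ₂ φ)).add (hY.sin.mul (hasDerivAt_bandVY hμ₁ hμ₂ φ))).const_mul 2
  refine h.congr_deriv ?_
  simp only [pairE₂₂]; ring

/-- Diagonal slice: `d/du G(w + u, u) = pairE₁ + pairE₂`. [folklore] -/
theorem hasDerivAt_pairE_diag (p : ℝ × ℝ) (w u : ℝ) :
    HasDerivAt (fun t => pairE μ p (w + t) t) (pairE₁ μ p (w + u) u + pairE₂ μ p (w + u) u) u := by
  have hxw : HasDerivAt (fun t => bandX μ (w + t)) (bandVX μ (w + u)) u := by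
    have h := (hasDerivAt_bandX hμ₁ hμ₂ (w + u)).comp_const_add w u
    exact h
  have hyw : HasDerivAt (fun t => bandY μ (w + t)) (bandVY μ (w + u)) u := by
    have h := (hasDerivAt_bandY hμ₁ hμ₂ (w + u)).comp_const_add w u
    exact h
  have hX : HasDerivAt (fun t => pairKX μ p (w + t) t) (bandVX μ (w + u) + bandVX μ u) u := by
    have h := (hxw.const_add p.1).add (hasDerivAt_bandX hμ₁ hμ₂ u)
    exact h
  have hY : HasDerivAt (fun t => pairKY μ p (w + t) t) (bandVY μ (w + u) + bandVY μ u) u := by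
    have h := (hyw.const_add p.2).add (hasDerivAt_bandY hμ₁ hμ₂ u)
    exact h
  have h := ((hX.cos.add hY.cos).const_mul (-2)).sub_const μ
  refine h.congr_deriv ?_
  simp only [pairE₁, pairE₂]; ring

/-- Diagonal slice: `d/du (pairE₁ + pairE₂)(w + u, u) = pairEdd`. [folklore] -/
theorem hasDerivAt_pairE₁₂_diag (p : ℝ × ℝ) (w u : ℝ) :
    HasDerivAt (fun t => pairE₁ μ p (w + t) t + pairE₂ μ p (w + t) t) (pairEdd μ p (w + u) u) u := by
  have hxw : HasDerivAt (fun t => bandX μ (w + t)) (bandVX μ (w + u)) u := by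
    have h := (hasDerivAt_bandX hμ₁ hμ₂ (w + u)).comp_const_add w u
    exact h
  have hyw : HasDerivAt (fun t => bandY μ (w + t)) (bandVY μ (w + u)) u := by
    have h := (hasDerivAt_bandY hμ₁ hμ₂ (w + u)).comp_const_add w u
    exact h
  have hvxw : HasDerivAt (fun t => bandVX μ (w + t)) (bandAX μ (w + u)) u := by
    have h := (hasDerivAt_bandVX hμ₁ hμ₂ (w + u)).comp_const_add w u
    exact h
  have hvyw : HasDerivAt (fun t => bandVY μ (w + t)) (bandAY μ (w + u)) u := by
    have h := (hasDerivAt_bandVY hμ₁ hμ₂ (w + u)).comp_const_add w u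
    exact h
  have hX : HasDerivAt (fun t => pairKX μ p (w + t) t) (bandVX μ (w + u) + bandVX μ u) u := by
    have h := (hxw.const_add p.1).add (hasDerivAt_bandX hμ₁ hμ₂ u)
    exact h
  have hY : HasDerivAt (fun t => pairKY μ p (w + t) t) (bandVY μ (w + u) + bandVY μ u) u := by
    have h := (hyw.const_add p.2).add (hasDerivAt_bandY hμ₁ hμ₂ u)
    exact h
  -- `pairE₁ + pairE₂ = 2 (sin X (x'(w+u) + x'(u)) + sin Y (y'(w+u) + y'(u)))`
  have hsum : (fun t => pairE₁ μ p (w + t) t + pairE₂ μ p (w + t) t) = fun t =>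
      2 * (Real.sin (pairKX μ p (w + t) t) * (bandVX μ (w + t) + bandVX μ t) +
        Real.sin (pairKY μ p (w + t) t) * (bandVY μ (w + t) + bandVY μ t)) := by
    funext t; simp only [pairE₁, pairE₂]; ring
  rw [hsum]
  have hsx : HasDerivAt (fun t => bandVX μ (w + t) + bandVX μ t) (bandAX μ (w + u) + bandAX μ u) u :=
    hvxw.add (hasDerivAt_bandVX hμ₁ hμ₂ u)
  have hsy : HasDerivAt (fun t => bandVY μ (w + t) + bandVY μ t) (bandAY μ (w + u) + bandAY μ u) u :=
    hvyw.add (hasDerivAt_bandVY hμ₁ hμ₂ u)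
  have h := ((hX.sin.mul hsx).add (hY.sin.mul hsy)).const_mul 2
  refine h.congr_deriv ?_
  simp only [pairEdd, pairE₁₁, pairE₁₂, pairE₂₂]; ring

end Band

/-! ### Joint continuity -/

/-- **`u''` is jointly continuous in `(μ, θ)` on `(-4, 0) × ℝ`** (the `θ`-partial of the jointly
`C¹` closed form `u' = -∂_θF/∂_tF (θ, u(μ, θ))`). [folklore] -/
theorem continuousOn_bandRadiusDeriv2_uncurry :
    ContinuousOn (fun q : ℝ × ℝ => bandRadiusDeriv2 q.1 q.2) (Ioo (-4 : ℝ) 0 ×ˢ univ) := by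
  set U : Set (ℝ × ℝ) := Ioo (-4 : ℝ) 0 ×ˢ univ with hU
  have hUo : IsOpen U := isOpen_Ioo.prod isOpen_univ
  set g : ℝ × ℝ → ℝ := fun q => bandFermiRadiusDeriv q.1 q.2 with hg
  -- `g` is jointly `C¹`
  have hgc : ContDiffOn ℝ 1 g U := by
    have hu : ContDiffOn ℝ 1 (fun q : ℝ × ℝ => bandFermiRadius q.1 q.2) U := contDiffOn_bandFermiRadius_uncurry
    have hpair : ContDiffOn ℝ 1 (fun q : ℝ × ℝ => ((q.2, bandFermiRadius q.1 q.2) : ℝ × ℝ)) U :=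
      contDiffOn_snd.prodMk hu
    have hθ : ContDiff ℝ 1 (fun r : ℝ × ℝ => rayDispersionDθ r.1 r.2) := by unfold rayDispersionDθ; fun_prop
    have ht : ContDiff ℝ 1 (fun r : ℝ × ℝ => rayDispersionDt r.1 r.2) := by unfold rayDispersionDt; fun_prop
    have hnum := hθ.comp_contDiffOn hpair
    have hden := ht.comp_contDiffOn hpair
    have hne : ∀ q ∈ U, (fun r : ℝ × ℝ => rayDispersionDt r.1 r.2) ((q.2, bandFermiRadius q.1 q.2)) ≠ 0 :=
      fun q hq => (rayDispersionDt_bandFermiRadius_pos hq.1.1 hq.1.2 q.2).ne'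
    have h := (hnum.neg.div hden hne)
    refine h.congr fun q _ => ?_
    simp only [hg, bandFermiRadiusDeriv, Function.comp_apply, Pi.div_apply, neg_div]
  have hfd : ContinuousOn (fderiv ℝ g) U := hgc.continuousOn_fderiv_of_isOpen hUo le_rfl
  -- `u'' = fderiv g (μ, θ) (0, 1)`
  have hval : ∀ q ∈ U, bandRadiusDeriv2 q.1 q.2 = fderiv ℝ g q ((0 : ℝ), (1 : ℝ)) := by
    intro q hq
    have hdiff : DifferentiableAt ℝ g q := (hgc.differentiableOn one_ne_zero q hq).differentiableAt (hUo.mem_nhds hq)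
    have hline : HasDerivAt (fun t : ℝ => ((q.1, t) : ℝ × ℝ)) ((0 : ℝ), (1 : ℝ)) q.2 :=
      (hasDerivAt_const q.2 q.1).prodMk (hasDerivAt_id q.2)
    have hcomp := hdiff.hasFDerivAt.comp_hasDerivAt q.2 hline
    have hfun : (g ∘ fun t : ℝ => ((q.1, t) : ℝ × ℝ)) = bandFermiRadiusDeriv q.1 := by
      funext t; simp [hg]
    rw [hfun] at hcomp
    rw [bandRadiusDeriv2, hcomp.deriv]
  have hcont : ContinuousOn (fun q : ℝ × ℝ => fderiv ℝ g q ((0 : ℝ), (1 : ℝ))) U :=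
    (ContinuousLinearMap.apply ℝ ℝ (((0 : ℝ), (1 : ℝ)) : ℝ × ℝ)).continuous.comp_continuousOn hfd
  exact hcont.congr fun q hq => hval q hq

/-- Joint continuity of `(μ, θ) ↦ (x, y, x', y', x'', y'')` building blocks. [folklore] -/
theorem continuousOn_bandXY_uncurry :
    ContinuousOn (fun q : ℝ × ℝ => bandX q.1 q.2) (Ioo (-4 : ℝ) 0 ×ˢ univ) ∧
    ContinuousOn (fun q : ℝ × ℝ => bandY q.1 q.2) (Ioo (-4 : ℝ) 0 ×ˢ univ) ∧
    ContinuousOn (fun q : ℝ × ℝ => bandVX q.1 q.2) (Ioo (-4 : ℝ) 0 ×ˢ univ) ∧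
    ContinuousOn (fun q : ℝ × ℝ => bandVY q.1 q.2) (Ioo (-4 : ℝ) 0 ×ˢ univ) ∧
    ContinuousOn (fun q : ℝ × ℝ => bandAX q.1 q.2) (Ioo (-4 : ℝ) 0 ×ˢ univ) ∧
    ContinuousOn (fun q : ℝ × ℝ => bandAY q.1 q.2) (Ioo (-4 : ℝ) 0 ×ˢ univ) := by
  have hu := continuousOn_bandFermiRadius
  have hu' := continuousOn_bandFermiRadius_angleDeriv
  have hu'' := continuousOn_bandRadiusDeriv2_uncurry
  have hc : Continuous fun q : ℝ × ℝ => Real.cos q.2 := by fun_prop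
  have hs : Continuous fun q : ℝ × ℝ => Real.sin q.2 := by fun_prop
  refine ⟨?_, ?_, ?_, ?_, ?_, ?_⟩
  · exact hu.mul hc.continuousOn
  · exact hu.mul hs.continuousOn
  · exact (hu'.mul hc.continuousOn).sub (hu.mul hs.continuousOn)
  · exact (hu'.mul hs.continuousOn).add (hu.mul hc.continuousOn)
  · exact ((hu''.mul hc.continuousOn).sub ((continuousOn_const.mul hu').mul hs.continuousOn)).sub (hu.mul hc.continuousOn)
  · exact ((hu''.mul hs.continuousOn).add ((continuousOn_const.mul hu').mul hc.continuousOn)).sub (hu.mul hs.continuousOn)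

/-- The parameter space `(μ, p, θ, φ)` and its band part `{-4 < μ < 0}` (local notation). -/
local notation "𝕏" => ℝ × (ℝ × ℝ) × ℝ × ℝ

/-- **Joint continuity of the pair energy and its slice derivatives** in `z = (μ, p, θ, φ)` on
`{-4 < μ < 0}`. [folklore] -/
theorem continuousOn_pairE_all :
    ContinuousOn (fun z : 𝕏 => pairE z.1 z.2.1 z.2.2.1 z.2.2.2) {z : 𝕏 | z.1 ∈ Ioo (-4 : ℝ) 0} ∧
    ContinuousOn (fun z : 𝕏 => pairE₁ z.1 z.2.1 z.2.2.1 z.2.2.2) {z : 𝕏 | z.1 ∈ Ioo (-4 : ℝ) 0} ∧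
    ContinuousOn (fun z : 𝕏 => pairE₂ z.1 z.2.1 z.2.2.1 z.2.2.2) {z : 𝕏 | z.1 ∈ Ioo (-4 : ℝ) 0} ∧
    ContinuousOn (fun z : 𝕏 => pairE₁₁ z.1 z.2.1 z.2.2.1 z.2.2.2) {z : 𝕏 | z.1 ∈ Ioo (-4 : ℝ) 0} ∧
    ContinuousOn (fun z : 𝕏 => pairE₂₂ z.1 z.2.1 z.2.2.1 z.2.2.2) {z : 𝕏 | z.1 ∈ Ioo (-4 : ℝ) 0} ∧
    ContinuousOn (fun z : 𝕏 => pairEdd z.1 z.2.1 z.2.2.1 z.2.2.2) {z : 𝕏 | z.1 ∈ Ioo (-4 : ℝ) 0} := by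
  obtain ⟨hx, hy, hvx, hvy, hax, hay⟩ := continuousOn_bandXY_uncurry
  set S : Set 𝕏 := {z : 𝕏 | z.1 ∈ Ioo (-4 : ℝ) 0} with hS
  -- the two projections `(μ, θ)` and `(μ, φ)`
  have hπ₁ : ContinuousOn (fun z : 𝕏 => ((z.1, z.2.2.1) : ℝ × ℝ)) S := by fun_prop
  have hπ₂ : ContinuousOn (fun z : 𝕏 => ((z.1, z.2.2.2) : ℝ × ℝ)) S := by fun_prop
  have hm₁ : MapsTo (fun z : 𝕏 => ((z.1, z.2.2.1) : ℝ × ℝ)) S (Ioo (-4 : ℝ) 0 ×ˢ univ) :=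
    fun z hz => ⟨hz, mem_univ _⟩
  have hm₂ : MapsTo (fun z : 𝕏 => ((z.1, z.2.2.2) : ℝ × ℝ)) S (Ioo (-4 : ℝ) 0 ×ˢ univ) :=
    fun z hz => ⟨hz, mem_univ _⟩
  -- the twelve building blocks as functions of `z`
  have X1 := hx.comp hπ₁ hm₁; have X2 := hx.comp hπ₂ hm₂
  have Y1 := hy.comp hπ₁ hm₁; have Y2 := hy.comp hπ₂ hm₂
  have VX1 := hvx.comp hπ₁ hm₁; have VX2 := hvx.comp hπ₂ hm₂
  have VY1 := hvy.comp hπ₁ hm₁; have VY2 := hvy.comp hπ₂ hm₂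
  have AX1 := hax.comp hπ₁ hm₁; have AX2 := hax.comp hπ₂ hm₂
  have AY1 := hay.comp hπ₁ hm₁; have AY2 := hay.comp hπ₂ hm₂
  simp only [Function.comp_def] at X1 X2 Y1 Y2 VX1 VX2 VY1 VY2 AX1 AX2 AY1 AY2
  have hp1 : ContinuousOn (fun z : 𝕏 => z.2.1.1) S := by fun_prop
  have hp2 : ContinuousOn (fun z : 𝕏 => z.2.1.2) S := by fun_prop
  have hμ : ContinuousOn (fun z : 𝕏 => z.1) S := by fun_prop
  have KX : ContinuousOn (fun z : 𝕏 => pairKX z.1 z.2.1 z.2.2.1 z.2.2.2) S := (hp1.add X1).add X2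
  have KY : ContinuousOn (fun z : 𝕏 => pairKY z.1 z.2.1 z.2.2.1 z.2.2.2) S := (hp2.add Y1).add Y2
  have cX := Real.continuous_cos.comp_continuousOn KX
  have sX := Real.continuous_sin.comp_continuousOn KX
  have cY := Real.continuous_cos.comp_continuousOn KY
  have sY := Real.continuous_sin.comp_continuousOn KY
  simp only [Function.comp_def] at cX sX cY sY
  have E0 : ContinuousOn (fun z : 𝕏 => pairE z.1 z.2.1 z.2.2.1 z.2.2.2) S :=
    ((continuousOn_const.mul (cX.add cY)).sub hμ)
  have E1 : ContinuousOn (fun z : 𝕏 => pairE₁ z.1 z.2.1 z.2.2.1 z.2.2.2) S :=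
    continuousOn_const.mul ((sX.mul VX1).add (sY.mul VY1))
  have E2 : ContinuousOn (fun z : 𝕏 => pairE₂ z.1 z.2.1 z.2.2.1 z.2.2.2) S :=
    continuousOn_const.mul ((sX.mul VX2).add (sY.mul VY2))
  have E11 : ContinuousOn (fun z : 𝕏 => pairE₁₁ z.1 z.2.1 z.2.2.1 z.2.2.2) S :=
    continuousOn_const.mul (((cX.mul (VX1.pow 2)).add (sX.mul AX1)).add ((cY.mul (VY1.pow 2)).add (sY.mul AY1)))
  have E22 : ContinuousOn (fun z : 𝕏 => pairE₂₂ z.1 z.2.1 z.2.2.1 z.2.2.2) S :=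
    continuousOn_const.mul (((cX.mul (VX2.pow 2)).add (sX.mul AX2)).add ((cY.mul (VY2.pow 2)).add (sY.mul AY2)))
  have E12 : ContinuousOn (fun z : 𝕏 => pairE₁₂ z.1 z.2.1 z.2.2.1 z.2.2.2) S :=
    continuousOn_const.mul ((((cX.mul VX1).mul VX2)).add ((cY.mul VY1).mul VY2))
  refine ⟨E0, E1, E2, E11, E22, ?_⟩
  exact (E11.add (continuousOn_const.mul E12)).add E22

/-! ### Periodicity in `p` -/

/-- The pair energy and its derivatives are `2π`-periodic in each component of `p`. [folklore] -/
theorem pairE_all_periodic (μ : ℝ) (p : ℝ × ℝ) (m n : ℤ) (θ φ : ℝ) :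
    pairE μ (p.1 + m * (2 * π), p.2 + n * (2 * π)) θ φ = pairE μ p θ φ ∧
    pairE₁ μ (p.1 + m * (2 * π), p.2 + n * (2 * π)) θ φ = pairE₁ μ p θ φ ∧
    pairE₂ μ (p.1 + m * (2 * π), p.2 + n * (2 * π)) θ φ = pairE₂ μ p θ φ ∧
    pairE₁₁ μ (p.1 + m * (2 * π), p.2 + n * (2 * π)) θ φ = pairE₁₁ μ p θ φ ∧
    pairE₂₂ μ (p.1 + m * (2 * π), p.2 + n * (2 * π)) θ φ = pairE₂₂ μ p θ φ ∧
    pairEdd μ (p.1 + m * (2 * π), p.2 + n * (2 * π)) θ φ = pairEdd μ p θ φ := by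
  have hX : pairKX μ (p.1 + m * (2 * π), p.2 + n * (2 * π)) θ φ = pairKX μ p θ φ + m * (2 * π) := by
    simp only [pairKX]; ring
  have hY : pairKY μ (p.1 + m * (2 * π), p.2 + n * (2 * π)) θ φ = pairKY μ p θ φ + n * (2 * π) := by
    simp only [pairKY]; ring
  have hc1 := Real.cos_add_int_mul_two_pi (pairKX μ p θ φ) m
  have hs1 := Real.sin_add_int_mul_two_pi (pairKX μ p θ φ) m
  have hc2 := Real.cos_add_int_mul_two_pi (pairKY μ p θ φ) n
  have hs2 := Real.sin_add_int_mul_two_pi (pairKY μ p θ φ) n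
  simp only [pairEdd, pairE, pairE₁, pairE₂, pairE₁₁, pairE₂₂, pairE₁₂, hX, hY, hc1, hs1, hc2, hs2, and_self]

end Literature.MathematicalPhysics.QuantumLattice

end
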